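import Summits.Schanuel.Schanuel.Theorems.RootDecomp1KTwoBaseCell07

/-!
# RootDecomp1KTwoBaseCell — lens 1, generation 36 «TWO-BASE WALL CELL of 33364» (RootDecomp1KTwoBaseCell.lean f6aad3c3…, 1847 l) — continuation (RootDecomp1KTwoBaseCell08): §7 the cells against the LIVE item 33364: `finiteOrderLiouvilleSchanuel_twoBaseCell (hNW)` / `_pi`, multi-base forms

(lens-1 g36 `RootDecomp1KTwoBaseCell.lean`, sha256 f6aad3c3…cd39, own farm rc 0 · 0 sorry · axioms std; critic VERDICT STATUS L1729 PORT GO LOW;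
port by census-1 gen 15 in nine parts `RootDecomp1KTwoBaseCell01`–`09` — see the PORT NOTE of part 01; `--supports stmt-Schanuel-33364`; rung 0.)
-/

noncomputable section

open Complex IntermediateField Polynomial
open Summit.Schanuel.Schanuel.Theorems.RootDecomp1KHyper
open Summit.Schanuel.Schanuel.Theorems.RootDecomp1KHyper.HyperCell
open Summit.Schanuel.Schanuel.Theorems.RootDecomp1KGeneric
open Summit.Schanuel.Schanuel.Theorems.RootDecomp1KRelLiouvilleCell
open Summit.Schanuel.Schanuel.Theorems.RootDecomp1KLogLogCell (LogLogLiouville logLogLiouville_of_logSqLiouville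
  logLogLiouville_of_logHyperLiouville logLogLiouville_of_hyperLiouville)

namespace Summit.Schanuel.Schanuel.Theorems.RootDecomp1KTwoBaseCell

open LiouvilleNumber
open scoped Nat

/-! ## §7  The cells against the LIVE item, and the members `z_W`, `z_W^π` -/

section Cells
open LiouvilleNumber
open scoped Nat

/-- Cardinal bookkeeping (re-proof of the private Cell08 helper `sb_of_range_eq`, attributed): a tuple `z` whose range
is the range of a `Fin N`-tuple `w`, `z` injective, has `n ≤ N`, and the Schanuel field only sees `Set.range z`. -/
theorem sb_of_range_eq' {n N : ℕ} {z : Fin n → ℂ} {w : Fin N → ℂ} (hz : Function.Injective z)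
    (hrange : Set.range z = Set.range w) (hw : SB N w) :
    (n : Cardinal) ≤ Algebra.trdeg ℚ
      ↥(IntermediateField.adjoin ℚ (Set.range z ∪ Set.range (Complex.exp ∘ z))) := by
  have e : Set.range z ∪ Set.range (Complex.exp ∘ z) = Set.range w ∪ Set.range (Complex.exp ∘ w) := by
    rw [Set.range_comp, Set.range_comp, hrange]
  have hnN : (n : Cardinal) ≤ (N : Cardinal) :=
    calc (n : Cardinal) = Cardinal.mk (Fin n) := (Cardinal.mk_fin n).symm
      _ = Cardinal.mk (Set.range z) := (Cardinal.mk_range_eq z hz).symm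
      _ = Cardinal.mk (Set.range w) := by rw [hrange]
      _ ≤ Cardinal.mk (Fin N) := Cardinal.mk_range_le
      _ = N := Cardinal.mk_fin N
  rw [e]
  exact hnN.trans hw

/-- **ITEM 33364 ON THE TWO-BASE WALL CELL (e-version, mod `hNW`).** Binders of
`Summit.Schanuel.Schanuel.Theses.RootDecomp1K.FiniteOrderLiouvilleSchanuel` VERBATIM, with ONE line inserted after
`LinearIndependent ℚ z` — the cell `Set.range z = Set.range (1, ℓ₂, ℓ₃)`. The two Diophantine hypotheses are not used
by the proof (the conclusion holds outright on the cell); they are CERTIFIED at the member `z_W` below. -/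
theorem finiteOrderLiouvilleSchanuel_twoBaseCell (hNW : NWMeasure) :
    ∀ (n : ℕ) (z : Fin n → ℂ), LinearIndependent ℚ z →
      Set.range z = Set.range ![(1 : ℂ), ((liouvilleNumber 2 : ℝ) : ℂ), ((liouvilleNumber 3 : ℝ) : ℂ)] →
      (∀ ω : ℕ, ∃ h : Fin n → ℤ, h ≠ 0 ∧ ‖∑ i, (h i : ℂ) * z i‖ < 1 / (1 + ∑ i, (|h i| : ℝ)) ^ ω) →
      (¬ ∀ m : ℕ, ∃ h : Fin n → ℤ, h ≠ 0 ∧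
        ‖∑ i, (h i : ℂ) * z i‖ < Real.exp (-((1 + ∑ i, (|h i| : ℝ)) ^ m))) →
      (n : Cardinal) ≤ Algebra.trdeg ℚ
        ↥(IntermediateField.adjoin ℚ (Set.range z ∪ Set.range (Complex.exp ∘ z))) := by
  intro n z hz hrange _ _
  exact sb_of_range_eq' hz.injective hrange (sb_twoBaseCell hNW)

/-- **ITEM 33364 ON THE TWO-BASE WALL CELL, π-version — HYPOTHESIS-FREE.** Same binders verbatim, the cell line
`Set.range z = Set.range (π, πℓ₂, πℓ₃)`. -/
theorem finiteOrderLiouvilleSchanuel_twoBaseCell_pi :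
    ∀ (n : ℕ) (z : Fin n → ℂ), LinearIndependent ℚ z →
      Set.range z = Set.range ![(Real.pi : ℂ), (Real.pi : ℂ) * ((liouvilleNumber 2 : ℝ) : ℂ),
        (Real.pi : ℂ) * ((liouvilleNumber 3 : ℝ) : ℂ)] →
      (∀ ω : ℕ, ∃ h : Fin n → ℤ, h ≠ 0 ∧ ‖∑ i, (h i : ℂ) * z i‖ < 1 / (1 + ∑ i, (|h i| : ℝ)) ^ ω) →
      (¬ ∀ m : ℕ, ∃ h : Fin n → ℤ, h ≠ 0 ∧
        ‖∑ i, (h i : ℂ) * z i‖ < Real.exp (-((1 + ∑ i, (|h i| : ℝ)) ^ m))) →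
      (n : Cardinal) ≤ Algebra.trdeg ℚ
        ↥(IntermediateField.adjoin ℚ (Set.range z ∪ Set.range (Complex.exp ∘ z))) := by
  intro n z hz hrange _ _
  exact sb_of_range_eq' hz.injective hrange sb_twoBaseCell_pi

/-- **ITEM 33364 ON EVERY MULTI-BASE CELL `(1, ℓ_{b_1}, …, ℓ_{b_k})` (e-version, mod `hNW`)** — bases `b_i ≥ 2` with
injective weights (e.g. pairwise coprime). Binders verbatim + one cell line. -/
theorem finiteOrderLiouvilleSchanuel_multiBaseCell (hNW : NWMeasure) {k : ℕ} {b : Fin k → ℕ}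
    (hb : ∀ i, 2 ≤ b i) (hinj : Function.Injective fun m : Fin k →₀ ℕ => ∏ i, b i ^ m i) :
    ∀ (n : ℕ) (z : Fin n → ℂ), LinearIndependent ℚ z →
      Set.range z = Set.range (Fin.cons (1 : ℂ) (fun i => ((liouvilleNumber (b i) : ℝ) : ℂ))) →
      (∀ ω : ℕ, ∃ h : Fin n → ℤ, h ≠ 0 ∧ ‖∑ i, (h i : ℂ) * z i‖ < 1 / (1 + ∑ i, (|h i| : ℝ)) ^ ω) →
      (¬ ∀ m : ℕ, ∃ h : Fin n → ℤ, h ≠ 0 ∧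
        ‖∑ i, (h i : ℂ) * z i‖ < Real.exp (-((1 + ∑ i, (|h i| : ℝ)) ^ m))) →
      (n : Cardinal) ≤ Algebra.trdeg ℚ
        ↥(IntermediateField.adjoin ℚ (Set.range z ∪ Set.range (Complex.exp ∘ z))) := by
  intro n z hz hrange _ _
  exact sb_of_range_eq' hz.injective hrange (sb_multiBaseCell hNW hb hinj)

/-- **ITEM 33364 ON EVERY MULTI-BASE CELL, π-version `(π, πℓ_{b_1}, …, πℓ_{b_k})` — HYPOTHESIS-FREE.** -/
theorem finiteOrderLiouvilleSchanuel_multiBaseCell_pi {k : ℕ} {b : Fin k → ℕ}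
    (hb : ∀ i, 2 ≤ b i) (hinj : Function.Injective fun m : Fin k →₀ ℕ => ∏ i, b i ^ m i) :
    ∀ (n : ℕ) (z : Fin n → ℂ), LinearIndependent ℚ z →
      Set.range z = Set.range (Fin.cons (Real.pi : ℂ)
        (fun i => (Real.pi : ℂ) * ((liouvilleNumber (b i) : ℝ) : ℂ))) →
      (∀ ω : ℕ, ∃ h : Fin n → ℤ, h ≠ 0 ∧ ‖∑ i, (h i : ℂ) * z i‖ < 1 / (1 + ∑ i, (|h i| : ℝ)) ^ ω) →
      (¬ ∀ m : ℕ, ∃ h : Fin n → ℤ, h ≠ 0 ∧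
        ‖∑ i, (h i : ℂ) * z i‖ < Real.exp (-((1 + ∑ i, (|h i| : ℝ)) ^ m))) →
      (n : Cardinal) ≤ Algebra.trdeg ℚ
        ↥(IntermediateField.adjoin ℚ (Set.range z ∪ Set.range (Complex.exp ∘ z))) := by
  intro n z hz hrange _ _
  exact sb_of_range_eq' hz.injective hrange (sb_multiBaseCell_pi hb hinj)

/-- **ITEM 33364 ON THE THREE-BASE CELL `(π, πℓ₂, πℓ₃, πℓ₅)` — HYPOTHESIS-FREE** (the `k = 3` instance). -/
theorem finiteOrderLiouvilleSchanuel_threeBaseCell_pi :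
    ∀ (n : ℕ) (z : Fin n → ℂ), LinearIndependent ℚ z →
      Set.range z = Set.range ![(Real.pi : ℂ), (Real.pi : ℂ) * ((liouvilleNumber 2 : ℝ) : ℂ),
        (Real.pi : ℂ) * ((liouvilleNumber 3 : ℝ) : ℂ), (Real.pi : ℂ) * ((liouvilleNumber 5 : ℝ) : ℂ)] →
      (∀ ω : ℕ, ∃ h : Fin n → ℤ, h ≠ 0 ∧ ‖∑ i, (h i : ℂ) * z i‖ < 1 / (1 + ∑ i, (|h i| : ℝ)) ^ ω) →
      (¬ ∀ m : ℕ, ∃ h : Fin n → ℤ, h ≠ 0 ∧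
        ‖∑ i, (h i : ℂ) * z i‖ < Real.exp (-((1 + ∑ i, (|h i| : ℝ)) ^ m))) →
      (n : Cardinal) ≤ Algebra.trdeg ℚ
        ↥(IntermediateField.adjoin ℚ (Set.range z ∪ Set.range (Complex.exp ∘ z))) := by
  intro n z hz hrange _ _
  exact sb_of_range_eq' hz.injective hrange sb_threeBaseCell_pi

end Cells

end Summit.Schanuel.Schanuel.Theorems.RootDecomp1KTwoBaseCell
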